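import Summits.KontsevichZagierPeriods.KontsevichZagierPeriods.Theorems.SymplecticScissorsRealOnePeriodRelationsTorsionLayer
import Summits.KontsevichZagierPeriods.KontsevichZagierPeriods.Theorems.SymplecticScissorsRealOnePeriodRelationsMultiEllLayerHolds

/-!
# Crux `RealOnePeriodRelations` (stmt-KontsevichZagierPeriods-10042), line `nash-retraction-thin-strip`, reshape 10 (lead c8):
# the torsion (third-kind) layer on FAMILIES of non-CM curves

The transfer `stub_transferTors` of symbols on a torsion-punctured Weierstrass curve `C_T(L)` to `E_L ∪ 𝔾ₘ ∪ 𝔸¹` is local to the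
lattice `L` (algebraic invariants; complex multiplication irrelevant).  Composed with the MULTI-CURVE open-path sector of reshape 8
(`MultiEllLayer.manyIsoPaths_of_famStd semistabilityTheorem_famStd_holds`: arbitrary paths on any finite family of curves isogenous
into pairwise non-isogenous non-CM `M_i`, with the punctured lines, `𝔾ₘ`, `𝔸¹`) it gives:

* `huberWustholzCurvePeriods_torsionPunctured_family` — Huber–Wüstholz 13.3 (2) for symbols on the torsion-punctured curves
  `C_T(L)` of ALL members `L` of such a family (each with its own finite set `T` of torsion abscissae), on the `E_L`, the punctured
  lines, the `E_{M_i}`, `𝔾ₘ` and `𝔸¹` — third-kind periods with torsion residue divisor on a whole isogeny web;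
* `realOnePeriodRelations_torsionLayer_family` — the corresponding layer of the crux (rational representations, first/second-kind
  cells and tails AND torsion cells on every real curve of the family, value `0` ⇒ in `M₁`), UNCONDITIONALLY.

[cite: HuberWustholz2022, Thm 13.3 (2), §13.2, Ch. 15] [cite: BakerWustholz2007, Thm 6.15] [cite: KontsevichZagier2001, §1.2]
-/

noncomputable section

open scoped BigOperators Topology Polynomial PeriodPair
open Set Filter MeasureTheory MvPolynomial Complex
open Literature.NumberTheory.Transcendental Literature.NumberTheory.Transcendental.CurvePeriods
open Literature.NumberTheory.Transcendental.CurvePeriods.Ell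
open Summit.KontsevichZagierPeriods.SymplecticScissors.RealOnePeriodRelationsNegative (M₁ H₁)

namespace Summit.KontsevichZagierPeriods.SymplecticScissors.RealOnePeriodRelations

namespace TorsionLayer

/-- A real Weierstrass model `y² = x³ + Ax + B` of a lattice is smooth: `4A³ + 27B² ≠ 0`. [folklore] -/
theorem discr_ne_zero_of_model : ∀ (L : PeriodPair) {A B : ℝ}, L.g₂ = -4 * (A : ℂ) → L.g₃ = -4 * (B : ℂ) → 4 * A ^ 3 + 27 * B ^ 2 ≠ 0 := by
  intro L A B hL₂ hL₃ h
  apply L.discr_ne_zero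
  rw [hL₂, hL₃]
  have h' : ((4 * A ^ 3 + 27 * B ^ 2 : ℝ) : ℂ) = 0 := by rw [h]; simp
  push_cast at h'
  linear_combination (-16 : ℂ) * h'

/-- **Huber–Wüstholz, Theorem 13.3 (2), for the torsion-punctured curves of a whole isogeny web of non-CM curves** together with the
curves themselves, the punctured lines, `𝔾ₘ` and `𝔸¹` — arbitrary paths, all forms.  [cite: HuberWustholz2022, Thm 13.3 (2), §13.2, Ch. 15] -/
theorem huberWustholzCurvePeriods_torsionPunctured_family {J : Type} [Fintype J] [DecidableEq J] (M : J → PeriodPair)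
    (hM : ∀ i, IsAlgebraic ℚ (M i).g₂ ∧ IsAlgebraic ℚ (M i).g₃)
    (hiso : ∀ i j, i ≠ j → ¬ (M i).IsIsogenousTo (M j)) (hCM : ∀ i, ¬ (M i).HasCM)
    (c : PeriodSymbol →₀ ℂ) (hc : ∀ s, IsAlgebraic ℚ (c s))
    (hsupp : ∀ s ∈ c.support,
      (∃ (i : J) (L : PeriodPair) (α : ℂ), IsAlgebraic ℚ L.g₂ ∧ IsAlgebraic ℚ L.g₃ ∧ α ≠ 0 ∧ IsAlgebraic ℚ α ∧
          (∀ l ∈ L.lattice, α * l ∈ (M i).lattice) ∧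
          (s.Z = Ell.curve L ∨
            ∃ T : Finset ℂ, (∀ a ∈ T, ∃ v : ℂ, IsAlgPt L v ∧ (∃ n : ℕ, 1 ≤ n ∧ (n : ℂ) * v ∈ L.lattice) ∧ ℘[L] v = a) ∧
              s.Z = curveP L T)) ∨
      (∃ (r : ℕ) (a : Fin r → ℂ), Function.Injective a ∧ (∀ i, IsAlgebraic ℚ (a i)) ∧
          s.Z = (⟨2, 1, ![X 1 * ∏ i, (X 0 - C (a i)) - 1]⟩ : CurveData)) ∨
      (∃ i, s.Z = Ell.curve (M i)) ∨ s.Z = (⟨2, 1, ![X 0 * X 1 - 1]⟩ : CurveData) ∨ s.Z = CurveData.affineLine)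
    (h0 : evalCombination c = 0) :
    ∃ (k : ℕ) (ρ : Fin k → (PeriodSymbol →₀ ℂ)) (a : Fin k → ℂ),
      (∀ l, IsElementaryRelation (ρ l)) ∧ (∀ l, IsAlgebraic ℚ (a l)) ∧ c = ∑ l, a l • ρ l := by
  classical
  -- the target sector: the multi-curve open-path sector of reshape 8
  let P : PeriodSymbol → Prop := fun t =>
    (∃ (i : J) (L : PeriodPair) (α : ℂ), IsAlgebraic ℚ L.g₂ ∧ IsAlgebraic ℚ L.g₃ ∧ α ≠ 0 ∧ IsAlgebraic ℚ α ∧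
        (∀ l ∈ L.lattice, α * l ∈ (M i).lattice) ∧ t.Z = Ell.curve L) ∨
    (∃ (r : ℕ) (a : Fin r → ℂ), Function.Injective a ∧ (∀ i, IsAlgebraic ℚ (a i)) ∧
        t.Z = (⟨2, 1, ![X 1 * ∏ i, (X 0 - C (a i)) - 1]⟩ : CurveData)) ∨
    (∃ i, t.Z = Ell.curve (M i)) ∨ t.Z = (⟨2, 1, ![X 0 * X 1 - 1]⟩ : CurveData) ∨ t.Z = CurveData.affineLine
  have key : ∀ s : PeriodSymbol, ∃ V : PeriodSymbol →₀ ℂ, s ∈ c.support →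
      ((∀ t, IsAlgebraic ℚ (V t)) ∧
        (∃ (k : ℕ) (ρ : Fin k → (PeriodSymbol →₀ ℂ)) (a : Fin k → ℂ),
          (∀ l, IsElementaryRelation (ρ l)) ∧ (∀ l, IsAlgebraic ℚ (a l)) ∧ (Finsupp.single s 1 - V) = ∑ l, a l • ρ l) ∧
        (∀ t ∈ V.support, P t)) := by
    intro s
    by_cases hs : s ∈ c.support
    · rcases hsupp s hs with ⟨i, L, α, hL₂, hL₃, hα0, hαa, hαL, hZ⟩ | hrest
      · rcases hZ with hE | ⟨T, hT, hsZ⟩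
        · exact ⟨Finsupp.single s 1, fun _ => ⟨fun t => isAlgebraic_single_one_apply _ _,
            by rw [sub_self]; exact span_zero, fun t ht => by
              have h3 := (Finsupp.mem_support_single _ _ _).1 ht
              rw [h3.1]
              exact Or.inl ⟨i, L, α, hL₂, hL₃, hα0, hαa, hαL, hE⟩⟩⟩
        · obtain ⟨Z, hZ', ω, hω, γ⟩ := s
          dsimp only at hsZ
          subst hsZ
          have hTalg := isAlgebraic_of_torsionAbscissa L hT
          obtain rfl : hZ' = smoothP L hL₂ hL₃ hTalg := rfl
          obtain ⟨V, hValg, hVrel, hVsupp⟩ := stub_transferTors L hL₂ hL₃ T hT hTalg ω hω γ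
          refine ⟨V, fun _ => ⟨hValg, hVrel, fun t ht => ?_⟩⟩
          rcases hVsupp t ht with h | h | h
          · exact Or.inl ⟨i, L, α, hL₂, hL₃, hα0, hαa, hαL, h⟩
          · exact Or.inr (Or.inr (Or.inr (Or.inl h)))
          · exact Or.inr (Or.inr (Or.inr (Or.inr h)))
      · exact ⟨Finsupp.single s 1, fun _ => ⟨fun t => isAlgebraic_single_one_apply _ _,
          by rw [sub_self]; exact span_zero, fun t ht => by
            have h3 := (Finsupp.mem_support_single _ _ _).1 ht
            rw [h3.1]
            exact Or.inr hrest⟩⟩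
    · exact ⟨0, fun h => (hs h).elim⟩
  choose V hV using key
  exact span_of_transfer_finsupp c hc V (fun s hs => (hV s hs).1) (fun s hs => (hV s hs).2.1) P
    (fun s hs => (hV s hs).2.2)
    (fun c' hc' hsupp' h0' =>
      MultiEllLayer.manyIsoPaths_of_famStd MultiEllLayer.semistabilityTheorem_famStd_holds M hM hiso hCM c' hc' hsupp' h0') h0


/-! ## The real clothes on families -/

section Layer

variable {ι : Type} (A B : ι → ℝ) (L : ι → PeriodPair)

/-- CELLS of the family torsion layer: rational representations, elliptic cells and tails by `IsoLayer.isoCells`, torsion cells as they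
stand. [cite: KontsevichZagier2001, §1.2] -/
theorem torsCells_family (hA : ∀ j, IsAlgebraic ℚ (A j)) (hB : ∀ j, IsAlgebraic ℚ (B j)) :
    ∀ c : KZ.FormalRep, c ∈ AddSubgroup.closure ((fun r : KZ.IntegralRep 1 => KZ.of r) ''
      {r | r.IsRational ∨
        (∃ j, ∃ a b : ℝ, IsAlgebraic ℚ a ∧ IsAlgebraic ℚ b ∧ a < b ∧ r.domain = {z | z 0 ∈ Set.Ioo a b} ∧
          (∀ x ∈ Set.Ioo a b, 0 < x ^ 3 + A j * x + B j) ∧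
          ∃ P₁ P₂ P₃ : Polynomial (algebraicClosure ℚ ℝ), ∀ x ∈ Set.Ioo a b,
            r.integrand (fun _ => x) = Polynomial.aeval x P₁ + Polynomial.aeval x P₂ * Real.sqrt (x ^ 3 + A j * x + B j) +
              Polynomial.aeval x P₃ / Real.sqrt (x ^ 3 + A j * x + B j)) ∨
        (∃ j, ∃ e M' c₀ : ℝ, IsAlgebraic ℚ e ∧ IsAlgebraic ℚ M' ∧ IsAlgebraic ℚ c₀ ∧ e ^ 3 + A j * e + B j = 0 ∧
          0 < 3 * e ^ 2 + A j ∧ e < M' ∧ (∀ x : ℝ, e < x → 0 < x ^ 3 + A j * x + B j) ∧ r.domain = {z | M' < z 0} ∧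
          ∀ z ∈ r.domain, r.integrand z = c₀ / Real.sqrt ((z 0) ^ 3 + A j * (z 0) + B j)) ∨
        (∃ j, ∃ a b : ℝ, IsAlgebraic ℚ a ∧ IsAlgebraic ℚ b ∧ a < b ∧ r.domain = {z | z 0 ∈ Set.Ioo a b} ∧
          (∀ x ∈ Set.Ioo a b, 0 < x ^ 3 + A j * x + B j) ∧
          ∃ (k : ℕ) (c : Fin k → ℝ) (m : Fin k → ℕ) (P : Polynomial (algebraicClosure ℚ ℝ)),
            (∀ i, IsAlgebraic ℚ (c i)) ∧ (∀ i, c i ∉ Set.Icc a b) ∧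
            (∀ i, ∃ v : ℂ, v ∉ (L j).lattice ∧ (∃ n : ℕ, 1 ≤ n ∧ (n : ℂ) * v ∈ (L j).lattice) ∧ ℘[L j] v = (c i : ℂ)) ∧
            ∀ x ∈ Set.Ioo a b, r.integrand (fun _ => x) =
              Polynomial.aeval x P / ((∏ i, (x - c i) ^ m i) * Real.sqrt (x ^ 3 + A j * x + B j)))}) →
    ∃ N : KZ.IntegralRep 1 →₀ ℤ, (∀ ρ ∈ N.support,
      (ρ.domain = {z | z 0 ∈ Set.Ioo (0 : ℝ) 1} ∧
          ∃ P Q : Polynomial (algebraicClosure ℚ ℝ),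
            (∀ t ∈ Set.Ioo (0 : ℝ) 1, Polynomial.aeval t Q ≠ 0) ∧
            ∀ t ∈ Set.Ioo (0 : ℝ) 1, ρ.integrand (fun _ => t) = Polynomial.aeval t P / Polynomial.aeval t Q) ∨
        (∃ j, ∃ a b : ℝ, IsAlgebraic ℚ a ∧ IsAlgebraic ℚ b ∧ a < b ∧ ρ.domain = {z | z 0 ∈ Set.Ioo a b} ∧
          (∀ x ∈ Set.Ioo a b, 0 < x ^ 3 + A j * x + B j) ∧
          ∃ P₁ P₂ P₃ : Polynomial (algebraicClosure ℚ ℝ), ∀ x ∈ Set.Ioo a b,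
            ρ.integrand (fun _ => x) = Polynomial.aeval x P₁ + Polynomial.aeval x P₂ * Real.sqrt (x ^ 3 + A j * x + B j) +
              Polynomial.aeval x P₃ / Real.sqrt (x ^ 3 + A j * x + B j)) ∨
        (∃ j, ∃ a b : ℝ, IsAlgebraic ℚ a ∧ IsAlgebraic ℚ b ∧ a < b ∧ ρ.domain = {z | z 0 ∈ Set.Ioo a b} ∧
          (∀ x ∈ Set.Ioo a b, 0 < x ^ 3 + A j * x + B j) ∧
          ∃ (k : ℕ) (c : Fin k → ℝ) (m : Fin k → ℕ) (P : Polynomial (algebraicClosure ℚ ℝ)),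
            (∀ i, IsAlgebraic ℚ (c i)) ∧ (∀ i, c i ∉ Set.Icc a b) ∧
            (∀ i, ∃ v : ℂ, v ∉ (L j).lattice ∧ (∃ n : ℕ, 1 ≤ n ∧ (n : ℂ) * v ∈ (L j).lattice) ∧ ℘[L j] v = (c i : ℂ)) ∧
            ∀ x ∈ Set.Ioo a b, ρ.integrand (fun _ => x) =
              Polynomial.aeval x P / ((∏ i, (x - c i) ^ m i) * Real.sqrt (x ^ 3 + A j * x + B j)))) ∧
      c - N.sum (fun ρ m => m • KZ.of ρ) ∈ M₁ := by
  classical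
  intro c hc
  refine AddSubgroup.closure_induction (p := fun c _ => ∃ N : KZ.IntegralRep 1 →₀ ℤ, (∀ ρ ∈ N.support,
      (ρ.domain = {z | z 0 ∈ Set.Ioo (0 : ℝ) 1} ∧
          ∃ P Q : Polynomial (algebraicClosure ℚ ℝ),
            (∀ t ∈ Set.Ioo (0 : ℝ) 1, Polynomial.aeval t Q ≠ 0) ∧
            ∀ t ∈ Set.Ioo (0 : ℝ) 1, ρ.integrand (fun _ => t) = Polynomial.aeval t P / Polynomial.aeval t Q) ∨
        (∃ j, ∃ a b : ℝ, IsAlgebraic ℚ a ∧ IsAlgebraic ℚ b ∧ a < b ∧ ρ.domain = {z | z 0 ∈ Set.Ioo a b} ∧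
          (∀ x ∈ Set.Ioo a b, 0 < x ^ 3 + A j * x + B j) ∧
          ∃ P₁ P₂ P₃ : Polynomial (algebraicClosure ℚ ℝ), ∀ x ∈ Set.Ioo a b,
            ρ.integrand (fun _ => x) = Polynomial.aeval x P₁ + Polynomial.aeval x P₂ * Real.sqrt (x ^ 3 + A j * x + B j) +
              Polynomial.aeval x P₃ / Real.sqrt (x ^ 3 + A j * x + B j)) ∨
        (∃ j, ∃ a b : ℝ, IsAlgebraic ℚ a ∧ IsAlgebraic ℚ b ∧ a < b ∧ ρ.domain = {z | z 0 ∈ Set.Ioo a b} ∧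
          (∀ x ∈ Set.Ioo a b, 0 < x ^ 3 + A j * x + B j) ∧
          ∃ (k : ℕ) (c : Fin k → ℝ) (m : Fin k → ℕ) (P : Polynomial (algebraicClosure ℚ ℝ)),
            (∀ i, IsAlgebraic ℚ (c i)) ∧ (∀ i, c i ∉ Set.Icc a b) ∧
            (∀ i, ∃ v : ℂ, v ∉ (L j).lattice ∧ (∃ n : ℕ, 1 ≤ n ∧ (n : ℂ) * v ∈ (L j).lattice) ∧ ℘[L j] v = (c i : ℂ)) ∧
            ∀ x ∈ Set.Ioo a b, ρ.integrand (fun _ => x) =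
              Polynomial.aeval x P / ((∏ i, (x - c i) ^ m i) * Real.sqrt (x ^ 3 + A j * x + B j)))) ∧
      c - N.sum (fun ρ m => m • KZ.of ρ) ∈ M₁) ?_ ?_ ?_ ?_ hc
  · -- generators
    rintro _ ⟨r, hr, rfl⟩
    rcases hr with hrat | hcell | htail | htors
    · obtain ⟨N, hN, hrN⟩ := IsoLayer.isoCells A B hA hB (KZ.of r) (AddSubgroup.subset_closure ⟨r, Or.inl hrat, rfl⟩)
      exact ⟨N, fun ρ hρ => (hN ρ hρ).elim Or.inl (fun h => Or.inr (Or.inl h)), hrN⟩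
    · obtain ⟨N, hN, hrN⟩ := IsoLayer.isoCells A B hA hB (KZ.of r) (AddSubgroup.subset_closure ⟨r, Or.inr (Or.inl hcell), rfl⟩)
      exact ⟨N, fun ρ hρ => (hN ρ hρ).elim Or.inl (fun h => Or.inr (Or.inl h)), hrN⟩
    · obtain ⟨N, hN, hrN⟩ := IsoLayer.isoCells A B hA hB (KZ.of r) (AddSubgroup.subset_closure ⟨r, Or.inr (Or.inr htail), rfl⟩)
      exact ⟨N, fun ρ hρ => (hN ρ hρ).elim Or.inl (fun h => Or.inr (Or.inl h)), hrN⟩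
    · refine ⟨Finsupp.single r 1, fun ρ hρ => ?_, ?_⟩
      · rw [Finsupp.support_single _ one_ne_zero, Finset.mem_singleton] at hρ
        subst hρ
        exact Or.inr (Or.inr htors)
      · rw [Finsupp.sum_single_index (zero_zsmul _), one_zsmul, sub_self]
        exact M₁.zero_mem
  · exact ⟨0, by simp, by simp [M₁.zero_mem]⟩
  · rintro c c' _ _ ⟨N, hN, hcN⟩ ⟨N', hN', hcN'⟩
    refine ⟨N + N', fun ρ hρ => ?_, ?_⟩
    · rcases Finset.mem_union.mp (Finsupp.support_add hρ) with h | h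
      · exact hN ρ h
      · exact hN' ρ h
    · rw [Cells.combo_add]
      convert M₁.add_mem hcN hcN' using 1
      abel
  · rintro c _ ⟨N, hN, hcN⟩
    refine ⟨-N, fun ρ hρ => hN ρ (by simpa [Finsupp.support_neg] using hρ), ?_⟩
    rw [Cells.combo_neg]
    convert M₁.neg_mem hcN using 1
    abel

/-- ARCS of the family torsion layer: `IsoLayer.isoArcs` on rational and elliptic cells, `stub_torsArcs` on torsion cells.
[cite: HuberWustholz2022, §3.3.1] -/
theorem torsLayerArcs_family (hA : ∀ j, IsAlgebraic ℚ (A j)) (hB : ∀ j, IsAlgebraic ℚ (B j)) (hD : ∀ j, 4 * A j ^ 3 + 27 * B j ^ 2 ≠ 0)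
    (hL₂ : ∀ j, (L j).g₂ = -4 * (A j : ℂ)) (hL₃ : ∀ j, (L j).g₃ = -4 * (B j : ℂ)) :
    ∀ ρ : KZ.IntegralRep 1,
    ((ρ.domain = {z | z 0 ∈ Set.Ioo (0 : ℝ) 1} ∧
          ∃ P Q : Polynomial (algebraicClosure ℚ ℝ),
            (∀ t ∈ Set.Ioo (0 : ℝ) 1, Polynomial.aeval t Q ≠ 0) ∧
            ∀ t ∈ Set.Ioo (0 : ℝ) 1, ρ.integrand (fun _ => t) = Polynomial.aeval t P / Polynomial.aeval t Q) ∨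
        (∃ j, ∃ a b : ℝ, IsAlgebraic ℚ a ∧ IsAlgebraic ℚ b ∧ a < b ∧ ρ.domain = {z | z 0 ∈ Set.Ioo a b} ∧
          (∀ x ∈ Set.Ioo a b, 0 < x ^ 3 + A j * x + B j) ∧
          ∃ P₁ P₂ P₃ : Polynomial (algebraicClosure ℚ ℝ), ∀ x ∈ Set.Ioo a b,
            ρ.integrand (fun _ => x) = Polynomial.aeval x P₁ + Polynomial.aeval x P₂ * Real.sqrt (x ^ 3 + A j * x + B j) +
              Polynomial.aeval x P₃ / Real.sqrt (x ^ 3 + A j * x + B j)) ∨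
        (∃ j, ∃ a b : ℝ, IsAlgebraic ℚ a ∧ IsAlgebraic ℚ b ∧ a < b ∧ ρ.domain = {z | z 0 ∈ Set.Ioo a b} ∧
          (∀ x ∈ Set.Ioo a b, 0 < x ^ 3 + A j * x + B j) ∧
          ∃ (k : ℕ) (c : Fin k → ℝ) (m : Fin k → ℕ) (P : Polynomial (algebraicClosure ℚ ℝ)),
            (∀ i, IsAlgebraic ℚ (c i)) ∧ (∀ i, c i ∉ Set.Icc a b) ∧
            (∀ i, ∃ v : ℂ, v ∉ (L j).lattice ∧ (∃ n : ℕ, 1 ≤ n ∧ (n : ℂ) * v ∈ (L j).lattice) ∧ ℘[L j] v = (c i : ℂ)) ∧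
            ∀ x ∈ Set.Ioo a b, ρ.integrand (fun _ => x) =
              Polynomial.aeval x P / ((∏ i, (x - c i) ^ m i) * Real.sqrt (x ^ 3 + A j * x + B j)))) →
    ∃ (C : PeriodSymbol →₀ ℂ) (R : PeriodSymbol → KZ.IntegralRep 1), (∀ s, IsAlgebraic ℚ (C s)) ∧
      (∀ s ∈ C.support,
        (∃ j, ∃ T : Finset ℂ, (∀ a ∈ T, ∃ v : ℂ, IsAlgPt (L j) v ∧ (∃ n : ℕ, 1 ≤ n ∧ (n : ℂ) * v ∈ (L j).lattice) ∧ ℘[L j] v = a) ∧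
          s.Z = curveP (L j) T) ∨
        (∃ (r : ℕ) (a : Fin r → ℂ), Function.Injective a ∧ (∀ i, IsAlgebraic ℚ (a i)) ∧
          s.Z = (⟨2, 1, ![X 1 * ∏ i, (X 0 - MvPolynomial.C (a i)) - 1]⟩ : CurveData)) ∨
        ∃ j, s.Z = weierCurve (A j : ℂ) (B j : ℂ)) ∧
      (∀ s ∈ C.support, IsSemialgebraicMapOn ℚ {z : Fin 1 → ℝ | z 0 ∈ Set.Icc (0 : ℝ) 1}
        (fun z => Fin.append (fun i => (s.γ.toFun (z 0) i).re) (fun i => (s.γ.toFun (z 0) i).im))) ∧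
      (∀ s ∈ C.support, (R s).domain = {z | z 0 ∈ Set.Ioo (0 : ℝ) 1} ∧ ∀ z ∈ (R s).domain, (R s).integrand z =
        (C s * ∑ i, MvPolynomial.eval (s.γ.toFun (z 0)) (s.ω i) * deriv (fun u => s.γ.toFun u i) (z 0)).re) ∧
      evalCombination C = ((ρ.value : ℝ) : ℂ) ∧ KZ.of ρ - ∑ s ∈ C.support, KZ.of (R s) ∈ M₁ := by
  rintro ρ (hrat | hcell | ⟨j, htors⟩)
  · obtain ⟨C, R, h1, h2, h3, h4, h5, h6⟩ := IsoLayer.isoArcs A B hA hB hD ρ (Or.inl hrat)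
    exact ⟨C, R, h1, fun s hs => Or.inr (h2 s hs), h3, h4, h5, h6⟩
  · obtain ⟨C, R, h1, h2, h3, h4, h5, h6⟩ := IsoLayer.isoArcs A B hA hB hD ρ (Or.inr hcell)
    exact ⟨C, R, h1, fun s hs => Or.inr (h2 s hs), h3, h4, h5, h6⟩
  · obtain ⟨C, R, h1, h2, h3, h4, h5, h6⟩ := stub_torsArcs (A j) (B j) (hA j) (hB j) (hD j) (L j) (hL₂ j) (hL₃ j) ρ htors
    exact ⟨C, R, h1, fun s hs => Or.inl ⟨j, h2 s hs⟩, h3, h4, h5, h6⟩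

end Layer

/-- **THE TORSION (THIRD-KIND) LAYER OF THE CRUX ON FAMILIES, UNCONDITIONALLY.**  Let `M_i` (`i ∈ J`, finite) be pairwise non-isogenous
non-CM lattices with algebraic invariants and `E_j : y² = x³ + A_j x + B_j` (`j ∈ ι`) real Weierstrass curves with lattices `L_j` isogenous
(`z ↦ α_j z`) into the `M_{κ j}`.  Every `ℤ`-combination with vanishing value of rational representations, first/second-kind real abelian
integrals and tails on the `E_j`, and TORSION CELLS `∫_a^b P(x) dx/(∏ᵢ (x − cᵢ)^{mᵢ} √f_j(x))` with real torsion abscissae `cᵢ` of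
`E_j` off `[a, b]` — third-kind incomplete elliptic integrals with torsion singular divisor on a whole isogeny web — lies in
`M₁ = closure (1a ∪ 1b ∪ 2 ∪ Green)`.  Proof: `SectorGlue.realOnePeriodRelations_of_sector` with `torsCells_family`,
`torsLayerArcs_family` and `huberWustholzCurvePeriods_torsionPunctured_family`.
[cite: HuberWustholz2022, Thm 13.3 (2), §13.2, Ch. 15] [cite: BakerWustholz2007, Thm 6.15] [cite: KontsevichZagier2001, §1.2] -/
theorem realOnePeriodRelations_torsionLayer_family : ∀ {ι J : Type} [Fintype J] [DecidableEq J]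
    (A B : ι → ℝ), (∀ j, IsAlgebraic ℚ (A j)) → (∀ j, IsAlgebraic ℚ (B j)) →
    ∀ (M : J → PeriodPair), (∀ i, IsAlgebraic ℚ (M i).g₂ ∧ IsAlgebraic ℚ (M i).g₃) →
    (∀ i j, i ≠ j → ¬ (M i).IsIsogenousTo (M j)) → (∀ i, ¬ (M i).HasCM) →
    ∀ (L : ι → PeriodPair) (κ : ι → J) (α : ι → ℂ), (∀ j, (L j).g₂ = -4 * (A j : ℂ)) → (∀ j, (L j).g₃ = -4 * (B j : ℂ)) →
    (∀ j, α j ≠ 0) → (∀ j, IsAlgebraic ℚ (α j)) → (∀ j, ∀ l ∈ (L j).lattice, α j * l ∈ (M (κ j)).lattice) →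
    ∀ c : KZ.FormalRep, c ∈ AddSubgroup.closure ((fun r : KZ.IntegralRep 1 => KZ.of r) ''
      {r | r.IsRational ∨
        (∃ j, ∃ a b : ℝ, IsAlgebraic ℚ a ∧ IsAlgebraic ℚ b ∧ a < b ∧ r.domain = {z | z 0 ∈ Set.Ioo a b} ∧
          (∀ x ∈ Set.Ioo a b, 0 < x ^ 3 + A j * x + B j) ∧
          ∃ P₁ P₂ P₃ : Polynomial (algebraicClosure ℚ ℝ), ∀ x ∈ Set.Ioo a b,
            r.integrand (fun _ => x) = Polynomial.aeval x P₁ + Polynomial.aeval x P₂ * Real.sqrt (x ^ 3 + A j * x + B j) +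
              Polynomial.aeval x P₃ / Real.sqrt (x ^ 3 + A j * x + B j)) ∨
        (∃ j, ∃ e M' c₀ : ℝ, IsAlgebraic ℚ e ∧ IsAlgebraic ℚ M' ∧ IsAlgebraic ℚ c₀ ∧ e ^ 3 + A j * e + B j = 0 ∧
          0 < 3 * e ^ 2 + A j ∧ e < M' ∧ (∀ x : ℝ, e < x → 0 < x ^ 3 + A j * x + B j) ∧ r.domain = {z | M' < z 0} ∧
          ∀ z ∈ r.domain, r.integrand z = c₀ / Real.sqrt ((z 0) ^ 3 + A j * (z 0) + B j)) ∨
        (∃ j, ∃ a b : ℝ, IsAlgebraic ℚ a ∧ IsAlgebraic ℚ b ∧ a < b ∧ r.domain = {z | z 0 ∈ Set.Ioo a b} ∧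
          (∀ x ∈ Set.Ioo a b, 0 < x ^ 3 + A j * x + B j) ∧
          ∃ (k : ℕ) (c : Fin k → ℝ) (m : Fin k → ℕ) (P : Polynomial (algebraicClosure ℚ ℝ)),
            (∀ i, IsAlgebraic ℚ (c i)) ∧ (∀ i, c i ∉ Set.Icc a b) ∧
            (∀ i, ∃ v : ℂ, v ∉ (L j).lattice ∧ (∃ n : ℕ, 1 ≤ n ∧ (n : ℂ) * v ∈ (L j).lattice) ∧ ℘[L j] v = (c i : ℂ)) ∧
            ∀ x ∈ Set.Ioo a b, r.integrand (fun _ => x) =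
              Polynomial.aeval x P / ((∏ i, (x - c i) ^ m i) * Real.sqrt (x ^ 3 + A j * x + B j)))}) →
    KZ.eval c = 0 →
    c ∈ AddSubgroup.closure (KZ.domainAddRel ∪ KZ.integrandAddRel ∪ KZ.changeOfVariablesRel ∪
      {g : KZ.FormalRep | ∃ (Δ : Set (Fin 2 → ℝ)) (A B S : (Fin 2 → ℝ) → ℝ) (r₀₁ r₁₂ r₀₂ : KZ.IntegralRep 1),
        Δ = {p | 0 ≤ p 0 ∧ 0 ≤ p 1 ∧ p 0 + p 1 ≤ 1} ∧ IsSemialgebraicFunOn ℚ Δ A ∧ IsSemialgebraicFunOn ℚ Δ B ∧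
        ContinuousOn A Δ ∧ ContinuousOn B Δ ∧
        (∀ p : Fin 2 → ℝ, 0 < p 0 → 0 < p 1 → p 0 + p 1 < 1 →
          HasFDerivAt S (A p • ContinuousLinearMap.proj (R := ℝ) (φ := fun _ : Fin 2 => ℝ) 0 +
            B p • ContinuousLinearMap.proj (R := ℝ) (φ := fun _ : Fin 2 => ℝ) 1) p) ∧
        r₀₁.domain = {z | z 0 ∈ Set.Ioo 0 1} ∧ r₁₂.domain = {z | z 0 ∈ Set.Ioo 0 1} ∧
        r₀₂.domain = {z | z 0 ∈ Set.Ioo 0 1} ∧ (∀ z ∈ r₀₁.domain, r₀₁.integrand z = A ![z 0, 0]) ∧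
        (∀ z ∈ r₁₂.domain, r₁₂.integrand z = B ![1 - z 0, z 0] - A ![1 - z 0, z 0]) ∧
        (∀ z ∈ r₀₂.domain, r₀₂.integrand z = B ![0, z 0]) ∧ g = KZ.of r₀₁ + KZ.of r₁₂ - KZ.of r₀₂}) := by
  intro ι J _ _ A B hA hB M hM hiso hCM L κ α hL₂ hL₃ hα hαalg hαM c hc heval
  change c ∈ M₁
  have hD : ∀ j, 4 * A j ^ 3 + 27 * B j ^ 2 ≠ 0 := fun j => discr_ne_zero_of_model (L j) (hL₂ j) (hL₃ j)
  have hg₂ : ∀ j, IsAlgebraic ℚ (L j).g₂ := fun j => by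
    rw [hL₂ j]; exact ((isAlgebraic_int 4).neg).mul (hA j).algebraMap
  have hg₃ : ∀ j, IsAlgebraic ℚ (L j).g₃ := fun j => by
    rw [hL₃ j]; exact ((isAlgebraic_int 4).neg).mul (hB j).algebraMap
  refine SectorGlue.realOnePeriodRelations_of_sector _ _ _ (fun C hCalg hCsupp hC0 => ?_)
    (torsCells_family A B L hA hB) (torsLayerArcs_family A B L hA hB hD hL₂ hL₃) c hc heval
  refine huberWustholzCurvePeriods_torsionPunctured_family M hM hiso hCM C hCalg (fun s hs => ?_) hC0
  rcases hCsupp s hs with ⟨j, T, hT, hZ⟩ | hP | ⟨j, hj⟩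
  · exact Or.inl ⟨κ j, L j, α j, hg₂ j, hg₃ j, hα j, hαalg j, hαM j, Or.inr ⟨T, hT, hZ⟩⟩
  · exact Or.inr (Or.inl hP)
  · exact Or.inl ⟨κ j, L j, α j, hg₂ j, hg₃ j, hα j, hαalg j, hαM j,
      Or.inl (hj.trans (Ell.curve_eq_weierCurve (hL₂ j) (hL₃ j)).symm)⟩

end TorsionLayer

end Summit.KontsevichZagierPeriods.SymplecticScissors.RealOnePeriodRelations

end
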